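import Literature.IUT.LogVolume.TensorPacketShell
import Literature.IUT.LogVolume.TensorPacketTransport
import HarnessLib

/-!
# Bounded regions of a tensor packet: uniform containers for their (Ind1)/(Ind2)-orbits and the
# admissibility of their hulls (Dupuy–Hilado §4.9–4.12; [IUTchIV] Thm. 1.10 Step (v))

Dupuy–Hilado, arXiv:2004.13228 (pre-split text) §4.11–4.12, read on the page (render chunk 16): "`U_Θ :=
Ind2(Ind1((O_𝕃(−P_Θ))^{Ind3}))` … The hull of `Ω ⊂ L` is then defined to be the smallest polydisc containing
`Ω`"; [IUTchIII] Cor. 3.12 (kurims p. 173): "it holds that `−|log(Θ)| ∈ ℝ`", i.e. the hull of `U_Θ` has FINITE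
log-volume; [IUTchIV] Thm. 1.10 Step (v) (kurims p. 27–28): the hull of the union of the (Ind1)/(Ind2)-images
is bounded by a translate `p^{⌊λ−d_I−a_I⌋−b_I}·(R_I)^∼`.

WHAT THIS FILE PROVES for a packet `V = ⊗_{ℚ_p} k_i` (objects of `TensorPacketMeasure`/`Shell`/`Transport`
and abc-iut-S2's `packetHull`) — the classical facts behind "`−|log(Θ)| ∈ ℝ`":

* `IsPsiBounded A` — `ψ(A)` is bounded in `⊕_j L_j` (equivalently: relatively compact; independent of `ψ` since
  decompositions differ by linear homeomorphisms, not used); translates `c·(R_I)^∼` are bounded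
  (`isPsiBounded_smul_normalizedPacket`), boundedness passes along (Ind1) (`isPsiBounded_image_perm`);
* **bounded sets sit inside `p^{−N}·log_p(R_I^×)`** (`exists_subset_ppow_smul_logPacket`: `ψ(log_p(R_I^×))` is an
  OPEN subgroup, so it contains a ball, and `‖p^N·y‖ = p^{−N}‖y‖`);
* hence **a uniform container for the (Ind2)-orbit of a bounded set**: `exists_forall_indTwo_image_subset` —
  one nondegenerate translate `c·(R_I)^∼` (`c = p^{−N}·⊗h_i`) containing `φ(A)` for EVERY
  `φ ∈ Aut_{ℚ_p}(V : log_p(R_I^×))` (the automorphisms preserve `p^{−N}·log_p(R_I^×) ⊆ p^{−N}·⊗h·(R_I)^∼`);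
* admissibility of the hull of a region squeezed between a nondegenerate translate `t·(R_I)^∼` and such a
  container is then abc-iut-S2's `packetAdm_packetHull` (`TensorPacketHullVolume.lean`).

[cite: DupuyHilado2025, §4.11–4.12] [cite: Mochizuki2012, IUTchIV Thm. 1.10 proof Step (v) p. 27]
Classical `p`-adic functional analysis; nothing disputed. Deliberately NOT here: the (Ind3)-datum and `U_Θ` of a
model (summit-side), the VALUE of the hull's volume (Step (v): abc-iut-S8/S2/c312-d1).
-/

noncomputable section

open MeasureTheory Set Metric Bornology
open scoped TensorProduct NormedField Pointwise ENNReal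

namespace Literature.IUT.LogVolume

open Literature.NumberTheory.GaloisRepresentations.Ultrametric

variable (p : ℕ) [Fact p.Prime]
variable {I : Type} [Fintype I] [DecidableEq I]
variable (k : I → Type) [∀ i, NontriviallyNormedField (k i)] [∀ i, NormedAlgebra ℚ_[p] (k i)]
  [∀ i, IsUltrametricDist (k i)] [∀ i, ProperSpace (k i)]

/-! ## Bounded regions -/

section Bounded

omit [DecidableEq I] [∀ i, IsUltrametricDist (k i)] in
/-- A region `A ⊆ V` is **bounded** if `ψ(A)` is bounded in `⊕_j L_j` ("relatively compact", [IUTchIII]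
Rmk. 3.9.5 (i)). [cite: DupuyHilado2025, §4.12] -/
def IsPsiBounded (A : Set (PacketAlgebra p k)) : Prop := IsBounded (dEquiv p k '' A)

omit [DecidableEq I] [∀ i, IsUltrametricDist (k i)] in
/-- Subsets of bounded regions are bounded. [cite: DupuyHilado2025, §4.12] -/
theorem IsPsiBounded.subset {A B : Set (PacketAlgebra p k)} (hB : IsPsiBounded p k B) (h : A ⊆ B) :
    IsPsiBounded p k A :=
  IsBounded.subset hB (image_mono h)

omit [DecidableEq I] [∀ i, IsUltrametricDist (k i)] in
/-- Finite unions of bounded regions are bounded. [cite: DupuyHilado2025, §4.12] -/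
theorem isPsiBounded_iUnion {ι : Type} [Finite ι] {A : ι → Set (PacketAlgebra p k)}
    (h : ∀ i, IsPsiBounded p k (A i)) : IsPsiBounded p k (⋃ i, A i) := by
  unfold IsPsiBounded
  rw [image_iUnion]
  exact isBounded_iUnion.mpr h

variable [Nonempty I]

/-- **Translates `c·(R_I)^∼` are bounded** (for ANY `c`: `ψ(c·(R_I)^∼) = ψ(c)·Π O_{L_j}` lies in the polydisc of
radii `‖ψ(c)_j‖`). [cite: DupuyHilado2025, §4.12] -/
theorem isPsiBounded_smul_normalizedPacket (c : PacketAlgebra p k) :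
    IsPsiBounded p k (c • (normalizedPacket p k : Set (PacketAlgebra p k))) := by
  unfold IsPsiBounded
  rw [image_smul_eq, image_normalizedPacket_eq_coe, coe_piUnitBallStructure]
  refine (isBounded_polydisc (DFac p k) (fun j => ‖dEquiv p k c j‖)).subset ?_
  rintro _ ⟨y, hy, rfl⟩
  rw [mem_polydisc] at hy ⊢
  intro j
  show ‖(dEquiv p k c * y) j‖ ≤ ‖dEquiv p k c j‖
  rw [Pi.mul_apply, norm_mul]
  exact mul_le_of_le_one_right (norm_nonneg _) (hy j)

end Bounded

/-! ## Bounded regions lie in `p^{−N}·log_p(R_I^×)`; the uniform (Ind2)-container -/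

section Container

variable [Nonempty I]

omit [Fintype I] [DecidableEq I] [∀ i, IsUltrametricDist (k i)] [∀ i, ProperSpace (k i)] [Nonempty I] in
/-- `log_p(R_I^×)` is stable under multiplication by `p^N`, `N ≥ 0` (it is an additive group:
`p^N·w = w + ⋯ + w`). [cite: Mochizuki2012, IUTchIV Prop. 1.2 p. 10] -/
theorem ppow_natCast_smul_mem_logPacket (N : ℕ) {w : PacketAlgebra p k} (hw : w ∈ logPacket p k) :
    ppow p k N • w ∈ logPacket p k := by
  rw [ppow, zpow_natCast, ← Nat.cast_pow, map_natCast, smul_eq_mul, ← nsmul_eq_mul]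
  exact AddSubgroup.nsmul_mem _ hw _

/-- **A bounded region lies in `p^{−N}·log_p(R_I^×)` for some `N`**: `ψ(log_p(R_I^×))` is an open subgroup of
`⊕_j L_j`, so it contains a ball `B(0,r)`; if `ψ(A) ⊆ B̄(0,R)` and `p^N·r > R` then `p^N·ψ(A) ⊆ B(0,r)`.
[cite: DupuyHilado2025, §4 (intro)] -/
theorem exists_subset_ppow_smul_logPacket {A : Set (PacketAlgebra p k)} (hA : IsPsiBounded p k A) :
    ∃ N : ℕ, A ⊆ ppow p k (-(N : ℤ)) • (logPacket p k : Set (PacketAlgebra p k)) := by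
  -- a ball inside the open subgroup `ψ(log_p(R_I^×))`
  have hopen := isOpen_imageLogPacket p k
  have h0 : (0 : DSum p k) ∈ (imageLogPacket p k : Set (DSum p k)) := (imageLogPacket p k).zero_mem
  obtain ⟨r, hr, hball⟩ := Metric.isOpen_iff.mp hopen 0 h0
  -- a ball containing `ψ(A)`
  obtain ⟨R, hR⟩ := hA.subset_closedBall 0
  -- choose `N` with `R < p^N · r`
  have hp1 : (1 : ℝ) < p := by exact_mod_cast (Fact.out : p.Prime).one_lt
  obtain ⟨N, hN⟩ := pow_unbounded_of_one_lt (R / r) hp1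
  refine ⟨N, fun x hx => ?_⟩
  -- `p^N · x ∈ log_p(R_I^×)`
  have hpN : ‖((p : ℚ_[p]) ^ (N : ℤ))‖ = ((p : ℝ) ^ N)⁻¹ := by
    rw [Padic.norm_p_zpow, zpow_neg, zpow_natCast]
  have hmem : dEquiv p k (ppow p k N • x) ∈ (imageLogPacket p k : Set (DSum p k)) := by
    apply hball
    rw [mem_ball, dist_zero_right, ppow, Algebra.algebraMap_eq_smul_one, smul_eq_mul, smul_mul_assoc, one_mul,
      map_smul, norm_smul, hpN]
    have hxR : ‖dEquiv p k x‖ ≤ R := by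
      have := hR ⟨x, hx, rfl⟩
      rwa [mem_closedBall, dist_zero_right] at this
    have hpow : (0 : ℝ) < (p : ℝ) ^ N := pow_pos (by linarith) N
    rw [inv_mul_lt_iff₀ hpow]
    calc ‖dEquiv p k x‖ ≤ R := hxR
      _ < (p : ℝ) ^ N * r := by rwa [div_lt_iff₀ hr] at hN
  rw [coe_imageLogPacket] at hmem
  obtain ⟨w, hw, hwx⟩ := hmem
  have hwx' : w = ppow p k N • x := (dEquiv p k).injective hwx
  refine ⟨w, hw, ?_⟩
  -- `p^{-N} · (p^N · x) = x`
  have hp0 : (p : ℚ_[p]) ≠ 0 := by exact_mod_cast (Fact.out : p.Prime).ne_zero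
  show ppow p k (-(N : ℤ)) • w = x
  rw [hwx', smul_smul, ppow, ppow, ← map_mul, ← zpow_add₀ hp0, neg_add_cancel, zpow_zero, map_one, one_smul]

omit [Fintype I] [DecidableEq I] [∀ i, IsUltrametricDist (k i)] [∀ i, ProperSpace (k i)] [Nonempty I] in
/-- `φ(p^n·B) = p^n·φ(B)` for a `ℚ_p`-linear `φ`. [cite: Mochizuki2012, IUTchIV Prop. 1.2 p. 10] -/
theorem image_ppow_smul_eq (φ : PacketAlgebra p k ≃ₗ[ℚ_[p]] PacketAlgebra p k) (n : ℤ)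
    (B : Set (PacketAlgebra p k)) : φ '' (ppow p k n • B) = ppow p k n • φ '' B := by
  rw [ppow, Algebra.algebraMap_eq_smul_one, ← image_smul, ← image_smul, image_image, image_image]
  refine image_congr fun b _ => ?_
  simp

/-- **The uniform (Ind2)-container of a bounded region**: there is ONE nondegenerate `c ∈ V` (namely
`p^{−N}·⊗h_i`) with `φ(A) ⊆ c·(R_I)^∼` for EVERY `φ ∈ Aut_{ℚ_p}(V : log_p(R_I^×))` — since such `φ` preserve
`p^{−N}·log_p(R_I^×) ⊆ p^{−N}·⊗h·(R_I)^∼`. [cite: DupuyHilado2025, §4.9] -/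
theorem exists_forall_indTwo_image_subset {A : Set (PacketAlgebra p k)} (hA : IsPsiBounded p k A) :
    ∃ c : PacketAlgebra p k, (∀ j, dEquiv p k c j ≠ 0) ∧
      ∀ φ ∈ indTwo p k, φ '' A ⊆ c • (normalizedPacket p k : Set (PacketAlgebra p k)) := by
  obtain ⟨N, hN⟩ := exists_subset_ppow_smul_logPacket p k hA
  obtain ⟨h, hh0, hh⟩ := exists_logPacket_subset_purePacket_smul_normalizedPacket p k
  refine ⟨ppow p k (-(N : ℤ)) * purePacket p k h, fun j => ?_, fun φ hφ => ?_⟩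
  · rw [map_mul, Pi.mul_apply]
    refine mul_ne_zero ?_ (dEquiv_purePacket_ne_zero p k hh0 j)
    rw [psi_ppow_apply]
    exact zpow_ne_zero _ (prime_ne_zero p (DFac p k j))
  · calc φ '' A ⊆ φ '' (ppow p k (-(N : ℤ)) • (logPacket p k : Set (PacketAlgebra p k))) := image_mono hN
      _ = ppow p k (-(N : ℤ)) • (logPacket p k : Set (PacketAlgebra p k)) := by
          rw [image_ppow_smul_eq, image_logPacket_of_mem p k hφ]
      _ ⊆ ppow p k (-(N : ℤ)) • (purePacket p k h • (normalizedPacket p k : Set (PacketAlgebra p k))) :=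
          smul_set_mono hh
      _ = (ppow p k (-(N : ℤ)) * purePacket p k h) • (normalizedPacket p k : Set (PacketAlgebra p k)) := by
          rw [smul_smul]

end Container

/-! ## (Ind1) preserves boundedness -/

section PermBounded

variable (s : I → Type) [∀ i, NontriviallyNormedField (s i)] [∀ i, NormedAlgebra ℚ_[p] (s i)]
  [∀ i, IsUltrametricDist (s i)] [∀ i, ProperSpace (s i)] [Nonempty I]
variable (σ : Equiv.Perm I)

omit [DecidableEq I] [∀ i, IsUltrametricDist (s i)] [Nonempty I] in
/-- **The factor permutation preserves boundedness**: `ψ ∘ perm ∘ ψ'⁻¹` is a continuous linear map between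
finite-dimensional normed spaces (the image of the compact closure is compact). [cite: DupuyHilado2025, §4.7] -/
theorem isPsiBounded_image_perm {A : Set (PacketAlgebra p (fun i ↦ s (σ i)))}
    (hA : IsPsiBounded p (fun i ↦ s (σ i)) A) : IsPsiBounded p s (permAlgEquiv p s σ '' A) := by
  let Φ : DSum p (fun i ↦ s (σ i)) →ₗ[ℚ_[p]] DSum p s :=
    ((dEquiv p s).toLinearEquiv.toLinearMap.comp (permAlgEquiv p s σ).toLinearEquiv.toLinearMap).comp
      (dEquiv p (fun i ↦ s (σ i))).toLinearEquiv.symm.toLinearMap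
  have hΦ : Continuous Φ := LinearMap.continuous_of_finiteDimensional Φ
  have himage : dEquiv p s '' (permAlgEquiv p s σ '' A) = Φ '' (dEquiv p (fun i ↦ s (σ i)) '' A) := by
    rw [image_image, image_image]
    refine image_congr fun a _ => ?_
    simp [Φ]
  unfold IsPsiBounded at hA ⊢
  rw [himage]
  have hK : IsCompact (closure (dEquiv p (fun i ↦ s (σ i)) '' A)) := hA.isCompact_closure
  exact ((hK.image hΦ).isBounded).subset (image_mono subset_closure)

end PermBounded

end Literature.IUT.LogVolume

end
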